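import Summits.BirchSwinnertonDyer.BirchSwinnertonDyer.Theses.EisensteinPrimes
import Summits.BirchSwinnertonDyer.BirchSwinnertonDyer.Theorems.EisensteinPrimesInputs
import HarnessLib

/-!
# Route `EisensteinPrimes` (rung K5): the join `Assembly`, closed by the kernel certificate

The route's assembly item
`Summit.BirchSwinnertonDyer.BirchSwinnertonDyer.Theses.EisensteinPrimes.Assembly :=
  GoodLatticeBDPValue → MazurMCOnCellB → BSDpOnCellC → MazurMCOnX1RankZero → SchneiderOnX1TypeB →
    PublishedInputs → Summit.BirchSwinnertonDyer.Rank1Residual.Eisenstein.EisensteinPrimes`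
is exactly the Theorems-side bridge
`Theorems.EisensteinPrimesInputs.eisensteinPrimes_of_inputs_of_targetC` (p405898) with the twenty
published facts bundled as the conjunction `PublishedInputs`: the five cruxes are, by name, KY
Thm 3.0.8 at the good lattice (row A1), Mazur's main conjecture on every X2b pair (A10), `BSD(E,p)`
on every X2c pair = `X2.TargetC` (B11), Mazur's main conjecture on X1 in analytic rank `0` (A3) and
Schneider's conjecture for the canonical height on X1 type B in rank `1` (A2). Nothing is asserted:
the cruxes and the published facts stay hypotheses of `Assembly` itself.
[cite: KellerYin2024, Thm A] [cite: GreenbergVatsal2000, Thm 1.3] [cite: Miller2011LMS, Def 1.1]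
-/

set_option autoImplicit false
set_option linter.dupNamespace false

namespace Summit.BirchSwinnertonDyer.BirchSwinnertonDyer.Theorems

open Summit.BirchSwinnertonDyer.BirchSwinnertonDyer.Theses.EisensteinPrimes

/-- **The join of route `EisensteinPrimes` holds**: the five cruxes and the published-fact bundle
imply the rung-K5 leaf `EisensteinPrimes` (`BSDpOnClassX1 ∧ X2.Target`), by the kernel certificate
`EisensteinPrimesInputs.eisensteinPrimes_of_inputs_of_targetC` after destructuring
`PublishedInputs` into its twenty named facts. [cite: KellerYin2024, Thm A]
[cite: GreenbergVatsal2000, Thm 1.3] [cite: Miller2011LMS, Def 1.1] -/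
theorem eisensteinPrimes_assembly_proof :
    Summit.BirchSwinnertonDyer.BirchSwinnertonDyer.Theses.EisensteinPrimes.Assembly := by
  unfold Summit.BirchSwinnertonDyer.BirchSwinnertonDyer.Theses.EisensteinPrimes.Assembly
  intro h1 h2 h3 h4 h5 hP
  obtain ⟨h511, hCassels, hGV, hGr, hmodP, hmod, hHL, hGZQ, hGZ, hKo, hGZK, hS, hPR, hGVm, hWu, hJs,
    hJn, hHs, hHn, hGS⟩ := hP
  exact Summit.BirchSwinnertonDyer.BirchSwinnertonDyer.Theorems.EisensteinPrimesInputs.eisensteinPrimes_of_inputs_of_targetC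
    h1 h2 h3 h4 h5 h511 hCassels hGV hGr hmodP hmod hHL hGZQ hGZ hKo hGZK hS hPR hGVm hWu hJs hJn hHs hHn hGS

end Summit.BirchSwinnertonDyer.BirchSwinnertonDyer.Theorems
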